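import Summits.QuantumFields.YangMills.Theorems.UnitScaleTiltProp8ChartDoubleBarDeriv
import Summits.QuantumFields.YangMills.Theorems.UnitScaleTiltProp8ChartDoubleBarOneStep
import Summits.QuantumFields.YangMills.Theorems.UnitScaleTiltProp8ChartLocalityFlat
import Summits.QuantumFields.YangMills.Theorems.UnitScaleTiltProp8ChartKernelCauchy
import Summits.QuantumFields.YangMills.Theorems.UnitScaleTiltProp8ChartKernelTube
import Literature.MathematicalPhysics.QuantumFieldTheory.Balaban1983to89.B7Eq170Flat
import HarnessLib

/-!
# Route `UnitScaleTilt`, crux K1 «MinimiserStabilityRegPr» (stmt-QuantumFields-19200), stub V2′ `stub_halvingStep`, C_E node after RULING g26-№6 — (S4′) THE ONE-STEP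
# DOUBLE-BAR CHART IN LOG COORDINATES: `Φ(W)(c) := −i·log U̿(e^{iW})(c)` — zero at zero, two-block local, bounded on the read ball ((S3) B1), with flat derivative the
# straight tube `L·Q` (CERT-2's engine), HENCE its (148) kernel letter `hE` (✓`ChartKernelCauchy.ineq148_local`) modulo one-step holomorphy off the flat point;
# + the log-coordinate tower `−i·log U̿^{(m)}` obeys `V_{m+1} = Φ(V_m)` wherever the iterates are in the log-ball (round trip `exp ∘ log`)

Cell `ym3-torus` (HUMAN RULING D-0037: YM₃ on the torus is ladder rung R3, not the Clay problem), width seat `ym-ust-19936-w5` gen 3; `--supports stmt-QuantumFields-19200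
--as helper`; def-free, 0 sorry.  ★★OWNER ACK 20 (a): «(S4′) GO».

WHY.  The abstract tower ✓`ChartKernelTower.kernel_tower_bound`∕`tower_deriv_recursion` (p610533) wants, per level, a one-step map `Φ_m` on ALL level-`m` log variables with
(i) `Φ_m(0) = 0`, (ii) dependence on the two-block read set only, (iii) a sup letter there, (iv) flat derivative = the tube `T_m = L·Q`, (v) holomorphy near the orbit; then
✓`ChartKernelCauchy.ineq148_local` turns (i)–(v) into the `hE` letter and ✓`ChartKernelTube` supplies `hT`∕`ha`∕`hSa`∕`hcard`.  This file builds (i)–(iv) for the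
double-bar one step of ✓`Prop8ChartDoubleBar` (S1) from ✓B1 `norm_dbarAvgU_sub_one_le`, ✓(S4) `dbarAvgU_congr₂`, ✓CERT-2 `exists_hasFDerivAt_coe_dbarAvgU_flat`, and states
the `hE` letter with (v) DISPLAYED (B2's one-step holomorphy export, RULING g26-№7); it also records the exact recursion of the log-coordinate tower.
OBJECTS (inline, no `def`): level-`m` exponential configuration `e^{iW} := fun b => (Prop8Chart.isUnit_exp_I_eta 1 (W b)).unit`; one step
`Φ_m(W)(c) := (−i)•mlog ↑(dbarAvgU e^{iW} c)`; read set `Rd(c) := {b : both blockOf-ends of b in {c₋, c₊}}`.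
WHAT.  §1 `coe_expL`, `expL_zero`, `norm_coe_expL_sub_one_le` (`‖e^{iW_b} − 1‖ ≤ 2‖W_b‖`), `unit_expL_log` (round trip `e^{i·(−i log u)} = u` for `‖u − 1‖ < 1`), `log_expL`
(`−i·log e^{iW_b} = W_b` for `‖W_b‖ ≤ 1/5`).  §2 `logTower_succ` (`−i log U̿^{(m+1)}(c) = Φ_m(−i log U̿^{(m)})(c)` when level `m` is in the log-ball), `logTower_zero`.
§3 `phi_zero`, `phi_congr` (two-block locality), `norm_phi_le` (`‖Φ_m(W)(c)‖ ≤ 80ℓ·r` for `‖W‖ ≤ r` on `Rd(c)`, `400ℓr ≤ 1`).  §4 (matrices) `hasFDerivAt_phi_zero`∕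
`fderiv_phi_zero_apply` (`DΦ_m(0)w(c) = L·(Qw)(c)`).  §5 ★ `norm_fderiv_phiRem_le` — THE `hE` LETTER: for `400ℓR ≤ 1`, one-step holomorphy on the read ball (displayed), `‖V‖ ≤ s`
on `Rd(c)`, `s < R/8`: `‖D(Φ_m(·)(c) − L·Q(·)(c))(V)[w]‖ ≤ (2560ℓ/R)·s·Σ_{b∈Rd(c)}‖w b‖`.
HONEST SCOPE.  One-step bookkeeping + the Cauchy letter; the tower assembly (truncation to the read cone, geometric sizes from ✓`…DoubleBarIterSmall`, `kernel_tower_bound`)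
is the next file.  NOT a claim about the stub, the crux, the rung or the mass gap.

References: T. Bałaban, CMP **98** (1985) 17–51 [Balaban1985Averaging] ((89) p.31, (122)–(125) p.36, (134) p.38, (140) p.39, (148) p.40, (150)–(152) pp.40–41).
-/

noncomputable section

open scoped BigOperators Matrix.Norms.L2Operator
open NormedSpace Metric

namespace Summit.QuantumFields.YangMills.Theorems.ChartKernelFlat

open Literature.MathematicalPhysics.QuantumFieldTheory.Balaban1983to89
open T4Continuum BlockAveraging MatrixLog
open LatticeFieldCalculus (bondAvg)
open Summit.QuantumFields.YangMills.Theorems.Prop8Chart (isUnit_exp_I_eta expCfg coe_expCfg)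
open Summit.QuantumFields.YangMills.Theorems.Prop8ChartDoubleBar

variable {P : Params}

/-! ## §1 The level-`m` exponential configuration and its log coordinates -/

section ExpL

variable {m : ℕ} {𝔸 : Type*} [NormedRing 𝔸] [NormedAlgebra ℂ 𝔸] [CompleteSpace 𝔸]

/-- the value of the level-`m` exponential configuration: `↑(e^{iW})_b = exp(i·W_b)`. [cite: Balaban1985Variational, (152) p.301] -/
theorem coe_expL (W : PBond P m → 𝔸) (b : PBond P m) :
    (((isUnit_exp_I_eta 1 (W b)).unit : 𝔸ˣ) : 𝔸) = exp (Complex.I • W b) := by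
  rw [IsUnit.unit_spec, Complex.ofReal_one, mul_one]

/-- the flat log configuration exponentiates to the flat field. [cite: Balaban1985Variational, (152) p.301] -/
theorem expL_zero : (fun b : PBond P m => (isUnit_exp_I_eta 1 ((0 : PBond P m → 𝔸) b)).unit) = fun _ => (1 : 𝔸ˣ) := by
  funext b
  apply Units.ext
  rw [coe_expL, Pi.zero_apply, smul_zero, exp_zero, Units.val_one]

omit [CompleteSpace 𝔸] in
/-- `‖i•a‖ = ‖a‖`. [folklore] -/
theorem norm_I_smul' (a : 𝔸) : ‖(Complex.I • a : 𝔸)‖ = ‖a‖ := by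
  rw [norm_smul, Complex.norm_I, one_mul]

/-- `‖e^{iW_b} − 1‖ ≤ 2‖W_b‖` for `‖W_b‖ ≤ 1`. [cite: Balaban1985Averaging, (122)-(123) p.36] -/
theorem norm_coe_expL_sub_one_le [NormOneClass 𝔸] (W : PBond P m → 𝔸) (b : PBond P m) (h : ‖W b‖ ≤ 1) :
    ‖(((isUnit_exp_I_eta 1 (W b)).unit : 𝔸ˣ) : 𝔸) - 1‖ ≤ 2 * ‖W b‖ := by
  rw [coe_expL]
  have h1 : ‖(Complex.I • W b : 𝔸)‖ ≤ 1 := by rw [norm_I_smul']; exact h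
  have := (Prop8Chart.norm_exp_sub_one_sub_le_sq h1).1
  rwa [norm_I_smul'] at this

/-- **ROUND TRIP**: for a unit `u` with `‖u − 1‖ < 1`, `e^{i·(−i·log u)} = u` (✓`MatrixLog.exp_mlog`). [cite: Balaban1985Averaging, (21) p.21] -/
theorem unit_expL_log (u : 𝔸ˣ) (hu : ‖(u : 𝔸) - 1‖ < 1) :
    (isUnit_exp_I_eta 1 ((-Complex.I) • mlog (u : 𝔸))).unit = u := by
  apply Units.ext
  rw [IsUnit.unit_spec, Complex.ofReal_one, mul_one, smul_smul, show Complex.I * -Complex.I = 1 by rw [mul_neg, Complex.I_mul_I, neg_neg],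
    one_smul, exp_mlog hu]

/-- `−i·log e^{iW_b} = W_b` for `‖W_b‖ ≤ 1/5` (✓`B7Eq170Flat.mlog_exp_of_le`). [cite: Balaban1985Averaging, (21) p.21] -/
theorem log_expL (W : PBond P m → 𝔸) (b : PBond P m) (h : ‖W b‖ ≤ 1 / 5) :
    (-Complex.I) • mlog ((((isUnit_exp_I_eta 1 (W b)).unit : 𝔸ˣ) : 𝔸)) = W b := by
  rw [coe_expL, B7Eq170Flat.mlog_exp_of_le (by rw [norm_I_smul']; exact h), smul_smul,
    show -Complex.I * Complex.I = 1 by rw [neg_mul, Complex.I_mul_I, neg_neg], one_smul]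

/-- The level-`0` exponential configuration of `η•A` is `expCfg η A`. [cite: Balaban1985Variational, (152) p.301] -/
theorem expL_smul_eq_expCfg (η : ℝ) (A : PBond P 0 → 𝔸) :
    (fun b : PBond P 0 => (isUnit_exp_I_eta 1 (((η : ℂ) • A) b)).unit) = expCfg η A := by
  funext b
  apply Units.ext
  rw [coe_expL, coe_expCfg, Pi.smul_apply, smul_smul]

end ExpL

/-! ## §2 The log-coordinate tower -/

section Tower

variable {𝔸 : Type*} [NormedRing 𝔸] [NormedAlgebra ℂ 𝔸] [CompleteSpace 𝔸]

/-- **THE RECURSION OF THE LOG-COORDINATE TOWER** ([Balaban1985Averaging] (150): `Q_{j+1}(U₀, ηA) = Q(·, Q_j(U₀, ηA))`): if every level-`m` double-bar iterate of `U` is in the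
log-ball, then `−i·log U̿^{(m+1)}(U)(c) = Φ_m(−i·log U̿^{(m)}(U))(c)` with `Φ_m(W)(c) = −i·log U̿(e^{iW})(c)`. [cite: Balaban1985Averaging, (150)-(152) pp.40-41] -/
theorem logTower_succ (m : ℕ) (U : GaugeField P 0 𝔸ˣ) (hsmall : ∀ c' : PBond P m, ‖((dbarIterU m U c' : 𝔸ˣ) : 𝔸) - 1‖ < 1) (c : PBond P (m + 1)) :
    (-Complex.I) • mlog (((dbarIterU (m + 1) U c : 𝔸ˣ) : 𝔸)) =
      (-Complex.I) • mlog (((dbarAvgU (fun c' : PBond P m => (isUnit_exp_I_eta 1 (((-Complex.I) • mlog (((dbarIterU m U c' : 𝔸ˣ) : 𝔸))))).unit) c : 𝔸ˣ) : 𝔸)) := by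
  have hfield : (fun c' : PBond P m => (isUnit_exp_I_eta 1 (((-Complex.I) • mlog (((dbarIterU m U c' : 𝔸ˣ) : 𝔸))))).unit) = dbarIterU m U :=
    funext fun c' => unit_expL_log _ (hsmall c')
  rw [hfield, dbarIterU_succ]

/-- The level-`0` log coordinates of `e^{iηA}` are `η•A` (on the window `‖ηA_b‖ ≤ 1/5`). [cite: Balaban1985Variational, (152) p.301] -/
theorem logTower_zero (η : ℝ) (A : PBond P 0 → 𝔸) (b : PBond P 0) (h : ‖((η : ℂ) • A) b‖ ≤ 1 / 5) :
    (-Complex.I) • mlog (((dbarIterU 0 (expCfg η A) b : 𝔸ˣ) : 𝔸)) = ((η : ℂ) • A) b := by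
  rw [dbarIterU_zero, ← expL_smul_eq_expCfg η A]
  exact log_expL ((η : ℂ) • A) b h

end Tower

/-! ## §3 The one step in log coordinates: zero, locality, sup letter -/

section OneStep

variable {m : ℕ} {𝔸 : Type*} [NormedRing 𝔸] [NormedAlgebra ℂ 𝔸] [CompleteSpace 𝔸] [NormOneClass 𝔸]

omit [NormOneClass 𝔸] in
/-- **`Φ_m(0) = 0`**: the flat log configuration averages to the flat field. [cite: Balaban1985Averaging, (134) p.38] -/
theorem phi_zero (c : PBond P (m + 1)) :
    (-Complex.I) • mlog (((dbarAvgU (fun b : PBond P m => (isUnit_exp_I_eta 1 ((0 : PBond P m → 𝔸) b)).unit) c : 𝔸ˣ) : 𝔸)) = 0 := by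
  rw [expL_zero, dbarAvgU_one, Units.val_one, mlog_one, smul_zero]

omit [NormOneClass 𝔸] in
/-- **TWO-BLOCK LOCALITY OF `Φ_m(·)(c)`** (✓`dbarAvgU_congr₂`): it depends only on the log variables of the bonds with both ends in `B(c₋) ∪ B(c₊)` (standing range).
[cite: Balaban1985Averaging, (140) p.39, (89) p.31] -/
theorem phi_congr (hm : m + 1 ≤ P.m + P.K) (c : PBond P (m + 1)) {W W' : PBond P m → 𝔸}
    (h : ∀ b : PBond P m, (blockOf b.src = c.src ∨ blockOf b.src = c.tgt) → (blockOf b.tgt = c.src ∨ blockOf b.tgt = c.tgt) → W b = W' b) :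
    (-Complex.I) • mlog (((dbarAvgU (fun b : PBond P m => (isUnit_exp_I_eta 1 (W b)).unit) c : 𝔸ˣ) : 𝔸)) =
      (-Complex.I) • mlog (((dbarAvgU (fun b : PBond P m => (isUnit_exp_I_eta 1 (W' b)).unit) c : 𝔸ˣ) : 𝔸)) := by
  rw [dbarAvgU_congr₂ hm c (U := fun b : PBond P m => (isUnit_exp_I_eta 1 (W b)).unit)
    (U' := fun b : PBond P m => (isUnit_exp_I_eta 1 (W' b)).unit) fun b hs ht => by
      show (isUnit_exp_I_eta 1 (W b)).unit = (isUnit_exp_I_eta 1 (W' b)).unit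
      rw [h b hs ht]]

/-- **THE SUP LETTER ON THE READ BALL** (✓B1 `norm_dbarAvgU_sub_one_le` at `s = 2r`): if `‖W_b‖ ≤ r` on the two-block read set of `c` and `400ℓr ≤ 1` (`ℓ = (d+2)L`), then
`‖U̿(e^{iW})(c) − 1‖ ≤ 40ℓr ≤ 1/10` and `‖Φ_m(W)(c)‖ ≤ 80ℓ·r`. [cite: Balaban1985Averaging, (122)-(123) p.36, (89) p.31] -/
theorem norm_phi_le (hm : m + 1 ≤ P.m + P.K) (c : PBond P (m + 1)) {W : PBond P m → 𝔸} {r : ℝ} (hr0 : 0 ≤ r)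
    (hr : 400 * (((P.d + 2) * P.L : ℕ) : ℝ) * r ≤ 1)
    (hW : ∀ b : PBond P m, (blockOf b.src = c.src ∨ blockOf b.src = c.tgt) → (blockOf b.tgt = c.src ∨ blockOf b.tgt = c.tgt) → ‖W b‖ ≤ r) :
    ‖((dbarAvgU (fun b : PBond P m => (isUnit_exp_I_eta 1 (W b)).unit) c : 𝔸ˣ) : 𝔸) - 1‖ ≤ 40 * (((P.d + 2) * P.L : ℕ) : ℝ) * r ∧
      ‖(-Complex.I) • mlog (((dbarAvgU (fun b : PBond P m => (isUnit_exp_I_eta 1 (W b)).unit) c : 𝔸ˣ) : 𝔸))‖ ≤ 80 * (((P.d + 2) * P.L : ℕ) : ℝ) * r := by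
  set ℓ : ℝ := (((P.d + 2) * P.L : ℕ) : ℝ) with hℓ
  have hℓ1 : (1 : ℝ) ≤ ℓ := by
    rw [hℓ]; exact_mod_cast Nat.one_le_iff_ne_zero.mpr (Nat.mul_ne_zero (by omega) P.L_pos.ne')
  have hLℓ : (P.L : ℝ) ≤ ℓ := by
    rw [hℓ]; push_cast; nlinarith [(Nat.cast_nonneg P.d : (0 : ℝ) ≤ P.d), (Nat.cast_pos.2 P.L_pos : (0 : ℝ) < P.L)]
  have hℓr : ℓ * r ≤ 1 / 400 := by nlinarith
  have hr1 : r ≤ 1 := by nlinarith [mul_nonneg (by linarith : (0 : ℝ) ≤ ℓ) hr0]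
  -- the group-coordinate sizes on the two blocks
  have hS : ∀ b : PBond P m, (blockOf b.src = c.src ∨ blockOf b.src = c.tgt) → (blockOf b.tgt = c.src ∨ blockOf b.tgt = c.tgt) →
      ‖((((fun b : PBond P m => (isUnit_exp_I_eta 1 (W b)).unit) b : 𝔸ˣ)) : 𝔸) - 1‖ ≤ 2 * r := fun b hs ht =>
    (norm_coe_expL_sub_one_le W b ((hW b hs ht).trans hr1)).trans (by linarith [hW b hs ht])
  have h48 : 48 * ℓ * (2 * r) ≤ 1 := by nlinarith
  have hB1 := norm_dbarAvgU_sub_one_le hm (S := fun b : PBond P m => (isUnit_exp_I_eta 1 (W b)).unit) c (by linarith) h48 hS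
  have hsq : 3800 * ℓ ^ 2 * (2 * r) ^ 2 ≤ 38 * ℓ * r := by nlinarith [mul_nonneg (by linarith : (0 : ℝ) ≤ ℓ) hr0]
  have hgrp : ‖((dbarAvgU (fun b : PBond P m => (isUnit_exp_I_eta 1 (W b)).unit) c : 𝔸ˣ) : 𝔸) - 1‖ ≤ 40 * ℓ * r := by
    calc _ ≤ (P.L : ℝ) * (2 * r) + 3800 * ℓ ^ 2 * (2 * r) ^ 2 := hB1
      _ ≤ ℓ * (2 * r) + 38 * ℓ * r := add_le_add (mul_le_mul_of_nonneg_right hLℓ (by linarith)) hsq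
      _ = 40 * ℓ * r := by ring
  refine ⟨hgrp, ?_⟩
  have hhalf : ‖((dbarAvgU (fun b : PBond P m => (isUnit_exp_I_eta 1 (W b)).unit) c : 𝔸ˣ) : 𝔸) - 1‖ ≤ 1 / 2 := hgrp.trans (by nlinarith)
  rw [norm_smul, norm_neg, Complex.norm_I, one_mul]
  calc _ ≤ 2 * ‖((dbarAvgU (fun b : PBond P m => (isUnit_exp_I_eta 1 (W b)).unit) c : 𝔸ˣ) : 𝔸) - 1‖ := norm_mlog_le_two_mul hhalf
    _ ≤ 2 * (40 * ℓ * r) := by linarith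
    _ = 80 * ℓ * r := by ring

end OneStep

/-! ## §4 The flat derivative of the one step is the straight tube (matrix algebras) -/

section Flat

variable {m : ℕ} {n : Type*} [Fintype n] [DecidableEq n]

/-- The level-`m` charted bond variable to first order at `W = 0`: `W ↦ e^{iW_b}` has derivative `w ↦ i·w_b`. [cite: Balaban1985Variational, (152) p.301] -/
theorem hasFDerivAt_coe_expL_zero (b : PBond P m) :
    HasFDerivAt (fun W : PBond P m → Matrix n n ℂ => (((isUnit_exp_I_eta 1 (W b)).unit : (Matrix n n ℂ)ˣ) : Matrix n n ℂ))
      ((Complex.I * ((1 : ℝ) : ℂ)) • ContinuousLinearMap.proj (R := ℂ) (φ := fun _ : PBond P m => Matrix n n ℂ) b) 0 := by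
  set ℓ : (PBond P m → Matrix n n ℂ) →L[ℂ] Matrix n n ℂ :=
    (Complex.I * ((1 : ℝ) : ℂ)) • ContinuousLinearMap.proj (R := ℂ) (φ := fun _ : PBond P m => Matrix n n ℂ) b with hℓ
  have hfun : (fun W : PBond P m → Matrix n n ℂ => (((isUnit_exp_I_eta 1 (W b)).unit : (Matrix n n ℂ)ˣ) : Matrix n n ℂ)) = fun W => exp (ℓ W) := by
    funext W; rw [IsUnit.unit_spec]; rfl
  rw [hfun]
  have hexp : HasFDerivAt (exp : Matrix n n ℂ → Matrix n n ℂ) (1 : Matrix n n ℂ →L[ℂ] Matrix n n ℂ) (ℓ 0) := by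
    rw [map_zero]; exact hasFDerivAt_exp_zero
  have h := hexp.comp (0 : PBond P m → Matrix n n ℂ) ℓ.hasFDerivAt
  rwa [ContinuousLinearMap.one_def, ContinuousLinearMap.id_comp] at h

/-- ★ **`DΦ_m(0) = L·Q`**: the one step in log coordinates has at `W = 0` the derivative `w ↦ L·(bondAvg w)(c)` (✓CERT-2's engine `exists_hasFDerivAt_coe_dbarAvgU_flat` — the frames cancel
the comb means — then `D log(1) = id` and `(−i)·i = 1`). [cite: Balaban1985Averaging, (125) p.36, (147) p.40] -/
theorem hasFDerivAt_phi_zero (c : PBond P (m + 1)) :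
    ∃ D : (PBond P m → Matrix n n ℂ) →L[ℂ] Matrix n n ℂ,
      HasFDerivAt (fun W : PBond P m → Matrix n n ℂ =>
        (-Complex.I) • mlog (((dbarAvgU (fun b : PBond P m => (isUnit_exp_I_eta 1 (W b)).unit) c : (Matrix n n ℂ)ˣ) : Matrix n n ℂ))) D 0 ∧
      ∀ w : PBond P m → Matrix n n ℂ, D w = ((P.L : ℕ) : ℂ) • bondAvg w c := by
  have h1 : ∀ b : PBond P m, (fun b' : PBond P m => (isUnit_exp_I_eta 1 ((0 : PBond P m → Matrix n n ℂ) b')).unit) b = 1 := fun b => by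
    rw [expL_zero]
  obtain ⟨D₁, hD₁, hD₁v⟩ := exists_hasFDerivAt_coe_dbarAvgU_flat
    (F := fun W : PBond P m → Matrix n n ℂ => fun b : PBond P m => (isUnit_exp_I_eta 1 (W b)).unit)
    (F' := fun b => (Complex.I * ((1 : ℝ) : ℂ)) • ContinuousLinearMap.proj (R := ℂ) (φ := fun _ : PBond P m => Matrix n n ℂ) b)
    (x₀ := 0) (fun b => hasFDerivAt_coe_expL_zero b) h1 c
  have hval : ((dbarAvgU (fun b : PBond P m => (isUnit_exp_I_eta 1 ((0 : PBond P m → Matrix n n ℂ) b)).unit) c : (Matrix n n ℂ)ˣ) : Matrix n n ℂ) = 1 := by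
    rw [expL_zero, dbarAvgU_one, Units.val_one]
  have hlog : HasFDerivAt (mlog : Matrix n n ℂ → Matrix n n ℂ) (1 : Matrix n n ℂ →L[ℂ] Matrix n n ℂ)
      (((dbarAvgU (fun b : PBond P m => (isUnit_exp_I_eta 1 ((0 : PBond P m → Matrix n n ℂ) b)).unit) c : (Matrix n n ℂ)ˣ) : Matrix n n ℂ)) := by
    rw [hval]; exact B7TransferAnalyticMean.hasFDerivAt_mlog_one
  have hcomp := hlog.comp (0 : PBond P m → Matrix n n ℂ) hD₁
  rw [ContinuousLinearMap.one_def, ContinuousLinearMap.id_comp] at hcomp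
  refine ⟨(-Complex.I) • D₁, hcomp.const_smul (-Complex.I), fun w => ?_⟩
  show (-Complex.I) • D₁ w = ((P.L : ℕ) : ℂ) • bondAvg w c
  have hF' : (fun b : PBond P m => ((Complex.I * ((1 : ℝ) : ℂ)) • ContinuousLinearMap.proj (R := ℂ) (φ := fun _ : PBond P m => Matrix n n ℂ) b) w) =
      fun b : PBond P m => Complex.I • w b := by
    funext b
    show (Complex.I * ((1 : ℝ) : ℂ)) • w b = Complex.I • w b
    rw [Complex.ofReal_one, mul_one]
  rw [hD₁v, hF', bondAvg_const_smul, smul_smul, smul_smul, show -Complex.I * ((P.L : ℕ) : ℂ) * Complex.I = ((P.L : ℕ) : ℂ) by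
    rw [mul_assoc, mul_comm ((P.L : ℕ) : ℂ) Complex.I, ← mul_assoc, neg_mul, Complex.I_mul_I, neg_neg, one_mul]]

/-- `fderiv` form of `hasFDerivAt_phi_zero`: `DΦ_m(0) w = L·(bondAvg w)(c)`. [cite: Balaban1985Averaging, (125) p.36] -/
theorem fderiv_phi_zero_apply (c : PBond P (m + 1)) (w : PBond P m → Matrix n n ℂ) :
    fderiv ℂ (fun W : PBond P m → Matrix n n ℂ =>
        (-Complex.I) • mlog (((dbarAvgU (fun b : PBond P m => (isUnit_exp_I_eta 1 (W b)).unit) c : (Matrix n n ℂ)ˣ) : Matrix n n ℂ))) 0 w =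
      ((P.L : ℕ) : ℂ) • bondAvg w c := by
  obtain ⟨D, hD, hDw⟩ := hasFDerivAt_phi_zero (n := n) (P := P) c
  rw [hD.fderiv, hDw]

end Flat

/-! ## §5 The (148) kernel letter of the one step (`hE` of the tower), modulo one-step holomorphy on the read ball -/

section Kernel

variable {m : ℕ} {n : Type*} [Fintype n] [DecidableEq n] [Nonempty n]

/-- ★ **THE `hE` LETTER FOR THE DOUBLE-BAR ONE STEP.**  Let `400ℓR ≤ 1`, `0 < R`, and suppose (v) ONE-STEP HOLOMORPHY ON THE READ BALL: `W ↦ Φ_m(W)(c)` is ℂ-differentiable at every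
`W` with `‖W_b‖ < R` on the two-block read set of `c` (B2's export, RULING g26-№7).  Then for every `V` with `‖V_b‖ ≤ s` on the read set, `0 ≤ s < R/8`, and every direction `w`:
`‖D(Φ_m(·)(c) − L·Q(·)(c))(V)[w]‖ ≤ (2560ℓ/R)·s·Σ_{b ∈ Rd(c)} ‖w b‖` — print's (148) for the ♭ one step, `C″ = 2560ℓ/R`, k-free (✓`ineq148_local` with `B = 80ℓR` from §3 and
`DΦ_m(0) = L·Q` from §4). [cite: Balaban1985Averaging, (148) p.40, (140) p.39] -/
theorem norm_fderiv_phiRem_le [DecidableEq (PBond P m)] (hm : m + 1 ≤ P.m + P.K) (c : PBond P (m + 1)) {R : ℝ} (hR : 0 < R)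
    (hR400 : 400 * (((P.d + 2) * P.L : ℕ) : ℝ) * R ≤ 1)
    (hdiffφ : ∀ W : PBond P m → Matrix n n ℂ,
      (∀ b : PBond P m, (blockOf b.src = c.src ∨ blockOf b.src = c.tgt) → (blockOf b.tgt = c.src ∨ blockOf b.tgt = c.tgt) → ‖W b‖ < R) →
      DifferentiableAt ℂ (fun W : PBond P m → Matrix n n ℂ =>
        (-Complex.I) • mlog (((dbarAvgU (fun b : PBond P m => (isUnit_exp_I_eta 1 (W b)).unit) c : (Matrix n n ℂ)ˣ) : Matrix n n ℂ))) W)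
    {V : PBond P m → Matrix n n ℂ} {s : ℝ} (hs0 : 0 ≤ s) (hs : s < R / 8)
    (hV : ∀ b : PBond P m, (blockOf b.src = c.src ∨ blockOf b.src = c.tgt) → (blockOf b.tgt = c.src ∨ blockOf b.tgt = c.tgt) → ‖V b‖ ≤ s)
    (w : PBond P m → Matrix n n ℂ) :
    ‖fderiv ℂ (fun W : PBond P m → Matrix n n ℂ =>
        (-Complex.I) • mlog (((dbarAvgU (fun b : PBond P m => (isUnit_exp_I_eta 1 (W b)).unit) c : (Matrix n n ℂ)ˣ) : Matrix n n ℂ)) -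
          ((P.L : ℕ) : ℂ) • bondAvg W c) V w‖ ≤
      2560 * (((P.d + 2) * P.L : ℕ) : ℝ) / R * s *
        ∑ b ∈ Finset.univ.filter (fun b : PBond P m => (blockOf b.src = c.src ∨ blockOf b.src = c.tgt) ∧ (blockOf b.tgt = c.src ∨ blockOf b.tgt = c.tgt)), ‖w b‖ := by
  set ℓ : ℝ := (((P.d + 2) * P.L : ℕ) : ℝ) with hℓ
  set Rd : Finset (PBond P m) :=
    Finset.univ.filter (fun b : PBond P m => (blockOf b.src = c.src ∨ blockOf b.src = c.tgt) ∧ (blockOf b.tgt = c.src ∨ blockOf b.tgt = c.tgt)) with hRd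
  set Φ : (PBond P m → Matrix n n ℂ) → Matrix n n ℂ := fun W =>
    (-Complex.I) • mlog (((dbarAvgU (fun b : PBond P m => (isUnit_exp_I_eta 1 (W b)).unit) c : (Matrix n n ℂ)ˣ) : Matrix n n ℂ)) with hΦ
  have hmemRd : ∀ b : PBond P m, b ∈ Rd ↔ (blockOf b.src = c.src ∨ blockOf b.src = c.tgt) ∧ (blockOf b.tgt = c.src ∨ blockOf b.tgt = c.tgt) := fun b => by
    rw [hRd, Finset.mem_filter]; simp
  -- hypotheses of `ineq148_local`
  have hdep : ∀ W W' : PBond P m → Matrix n n ℂ, (∀ b ∈ Rd, W b = W' b) → Φ W = Φ W' := fun W W' h =>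
    phi_congr hm c fun b hs ht => h b ((hmemRd b).2 ⟨hs, ht⟩)
  have hB0 : 0 ≤ 80 * ℓ * R := by have : (0 : ℝ) ≤ ℓ := Nat.cast_nonneg _; positivity
  have hdiff : ∀ W : PBond P m → Matrix n n ℂ, (∀ b ∈ Rd, ‖W b‖ < R) → DifferentiableAt ℂ Φ W := fun W h =>
    hdiffφ W fun b hs ht => h b ((hmemRd b).2 ⟨hs, ht⟩)
  have hB : ∀ W : PBond P m → Matrix n n ℂ, (∀ b ∈ Rd, ‖W b‖ < R) → ‖Φ W‖ ≤ 80 * ℓ * R := fun W h =>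
    (norm_phi_le hm c hR.le hR400 fun b hs ht => (h b ((hmemRd b).2 ⟨hs, ht⟩)).le).2
  have h0 : Φ 0 = 0 := phi_zero c
  have hVRd : ∀ b ∈ Rd, ‖V b‖ ≤ s := fun b hb => hV b ((hmemRd b).1 hb).1 ((hmemRd b).1 hb).2
  have hmain := ChartKernelCauchy.ineq148_local Rd Φ hdep hR hB0 hdiff hB h0 hs0 hs hVRd w
  -- the flat derivative is the tube
  have hrem : (fun W : PBond P m → Matrix n n ℂ => Φ W - ((P.L : ℕ) : ℂ) • bondAvg W c) = fun Z => Φ Z - fderiv ℂ Φ 0 Z := by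
    funext Z; rw [fderiv_phi_zero_apply]
  rw [hrem]
  calc ‖fderiv ℂ (fun Z => Φ Z - fderiv ℂ Φ 0 Z) V w‖ ≤ 32 * (80 * ℓ * R) / R ^ 2 * s * ∑ b ∈ Rd, ‖w b‖ := hmain
    _ = 2560 * ℓ / R * s * ∑ b ∈ Rd, ‖w b‖ := by
        have hR0 : R ≠ 0 := hR.ne'
        field_simp
        ring

end Kernel

end Summit.QuantumFields.YangMills.Theorems.ChartKernelFlat

end
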